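import Literature.NumberTheory.Sieve.BombieriAsymptoticSieveLemmata
import Literature.NumberTheory.Sieve.BombieriAsymptoticSieveSmoothPart
import Literature.NumberTheory.Sieve.SieveFrameworkProofs
import Mathlib.Analysis.SpecificLimits.Normed
import HarnessLib

/-!
# Bombieri's asymptotic sieve: the sifted subsequences of the `Σ₀`-estimate

Topic `Literature/NumberTheory/Sieve`, companion ("Proofs") file of `BombieriAsymptoticSieve.lean`
([BombieriRIMS1977]; [FriedlanderIwaniecPisa1978] Lemma 10 and §6, Lemmata 19, 24). All PROVED:

* `sum_divisors_primePow_abs_moebius_mul`, `sumAbsMoebius_primePow_mul`,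
  `sumMoebius_le_sumAbsMoebius` — the weight `G(q) = ∑_{e ∣ q} |μ(e)| g(qe)` is multiplicative
  over coprime prime powers (`G(p^a m) = (g(p^a) + g(p^{a+1})) G(m)`) and dominates
  `g♭(q) = ∑_{e ∣ q} μ(e) g(qe)`;
* `inv_one_sub_density_le`, `prod_primesBelow_not_dvd_le` — `(1 − g(p))⁻¹ ≤ 2K` under
  `HasSieveDimension g 1 K`, so `∏_{p<ζ, p ∤ q} (1 − g(p)) ≤ (2K)^k V(ζ)` for `ω(q) ≤ k`;
* `exists_pow_mul_geom_le`, `primePow_weight_sum_le` — `∑_{p<P} ∑_a (g(p^a)+g(p^{a+1}))(a log p)^c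
  ≪ (log P)^c` from (A₁), (A₅) (`∑_p |g(p) − 1/p| < ∞`) and Mertens;
* `sum_divisors_moebius_mul_indicator_dvd`, `sum_coprime_dvd_eq_sum_moebius_congrSum`,
  `sifted_subsequence_le`, `sum_smoothPart_eq_le`, `sumMoebius_density_nonneg` — the sifted
  sequence `C_q = (a_{qr} 1_{(r,q)=1})_r` (size `g♭(q) A(x)`, density `g` off `q`), the fundamental
  lemma applied to it ([FriedlanderIwaniecPisa1978] Lemma 19 in the form needed), `M(q) ≤ S(C_q, ζ)`,
  and `g♭(q) ≥ 0` (from (A₂)).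
-/

noncomputable section

namespace Literature.NumberTheory.Sieve

namespace BombieriSieve

open Finset ArithmeticFunction
open scoped ArithmeticFunction.Moebius ArithmeticFunction.vonMangoldt

/-! ### The weight `G(q) = ∑_{e ∣ q} |μ(e)| g(qe)` and the modified density `g♭(q) = ∑_{e ∣ q} μ(e) g(qe)` -/

/-- `∑_{e ∣ p^a} |μ(e)| g(p^a e) = g(p^a) + g(p^{a+1})` for a prime `p` and `a ≥ 1`... in fact for
all `a`: the squarefree divisors of `p^a` (`a ≥ 1`) are `1, p`. [folklore] -/
theorem sum_divisors_primePow_abs_moebius_mul (g : ℕ → ℝ) {p : ℕ} (hp : p.Prime) {a : ℕ}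
    (ha : 1 ≤ a) :
    ∑ e ∈ (p ^ a).divisors, |(μ e : ℝ)| * g (p ^ a * e) = g (p ^ a) + g (p ^ (a + 1)) := by
  rw [Nat.divisors_prime_pow hp, Finset.sum_map]
  simp only [Function.Embedding.coeFn_mk]
  obtain ⟨a', rfl⟩ : ∃ a', a = a' + 1 := ⟨a - 1, by omega⟩
  rw [Finset.sum_range_succ', Finset.sum_range_succ']
  have hrest : ∑ i ∈ Finset.range a', |(μ (p ^ (i + 1 + 1)) : ℝ)| * g (p ^ (a' + 1) * p ^ (i + 1 + 1)) = 0 := by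
    refine Finset.sum_eq_zero fun i _ => ?_
    rw [ArithmeticFunction.moebius_apply_prime_pow hp (by omega : i + 1 + 1 ≠ 0), if_neg (by omega)]
    simp
  rw [hrest, zero_add, pow_zero, mul_one, ArithmeticFunction.moebius_apply_one, pow_one,
    ArithmeticFunction.moebius_apply_prime hp]
  simp only [Int.cast_one, abs_one, one_mul, Int.cast_neg, abs_neg]
  rw [add_comm, ← pow_succ]

/-- **Multiplicativity of `G`**: for `p ∤ m` prime and `a ≥ 1`,
`G(p^a m) = (g(p^a) + g(p^{a+1})) G(m)` where `G(q) = ∑_{e ∣ q} |μ(e)| g(qe)` and `g` is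
multiplicative (the divisors of `p^a m` are `e₁ e₂`, `e₁ ∣ p^a`, `e₂ ∣ m`, `|μ(e₁e₂)| = |μ(e₁)||μ(e₂)|`,
`g(p^a m e₁ e₂) = g(p^a e₁) g(m e₂)`). [folklore] -/
theorem sumAbsMoebius_primePow_mul (g : ArithmeticFunction ℝ) (hg : g.IsMultiplicative) {p a m : ℕ}
    (hp : p.Prime) (ha : 1 ≤ a) (hpm : ¬ p ∣ m) :
    ∑ e ∈ (p ^ a * m).divisors, |(μ e : ℝ)| * g (p ^ a * m * e) =
      (g (p ^ a) + g (p ^ (a + 1))) * ∑ e ∈ m.divisors, |(μ e : ℝ)| * g (m * e) := by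
  have hcop : (p ^ a).Coprime m := Nat.Coprime.pow_left a (hp.coprime_iff_not_dvd.mpr hpm)
  rw [sum_divisors_mul_of_coprime hcop, ← sum_divisors_primePow_abs_moebius_mul g hp ha,
    Finset.sum_mul]
  refine Finset.sum_congr rfl fun e₁ he₁ => ?_
  rw [Finset.mul_sum]
  refine Finset.sum_congr rfl fun e₂ he₂ => ?_
  have h1 : e₁ ∣ p ^ a := Nat.dvd_of_mem_divisors he₁
  have h2 : e₂ ∣ m := Nat.dvd_of_mem_divisors he₂
  have hcop12 : e₁.Coprime e₂ := (hcop.coprime_dvd_left h1).coprime_dvd_right h2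
  have hcop' : (p ^ a * e₁).Coprime (m * e₂) := by
    -- `p^a e₁ ∣ p^{2a}` is a power of `p`, `m e₂ ∣ m²` is coprime to `p`
    have h3 : (p ^ a * e₁).Coprime m :=
      Nat.Coprime.mul_left hcop (hcop.coprime_dvd_left h1)
    have h4 : (p ^ a * e₁).Coprime e₂ :=
      Nat.Coprime.mul_left ((hcop.coprime_dvd_right h2)) hcop12
    exact Nat.Coprime.mul_right h3 h4
  rw [ArithmeticFunction.isMultiplicative_moebius.map_mul_of_coprime hcop12, Int.cast_mul, abs_mul,
    show p ^ a * m * (e₁ * e₂) = (p ^ a * e₁) * (m * e₂) by ring, hg.map_mul_of_coprime hcop']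
  ring

/-- `G(1) = g(1) = 1`, `G ≥ 0` for `g ≥ 0` (on positive integers), and `g♭(q) ≤ G(q)`:
`∑_{e ∣ q} μ(e) g(qe) ≤ ∑_{e ∣ q} |μ(e)| g(qe)`. [folklore] -/
theorem sumMoebius_le_sumAbsMoebius (g : ℕ → ℝ) (hg0 : ∀ n, 1 ≤ n → 0 ≤ g n) {q : ℕ} (hq : 1 ≤ q) :
    ∑ e ∈ q.divisors, (μ e : ℝ) * g (q * e) ≤ ∑ e ∈ q.divisors, |(μ e : ℝ)| * g (q * e) :=
  Finset.sum_le_sum fun e he => mul_le_mul_of_nonneg_right (le_abs_self _)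
    (hg0 _ (Nat.one_le_iff_ne_zero.mpr (Nat.mul_ne_zero (by omega)
      (Nat.pos_of_mem_divisors he).ne')))

/-! ### `(1 − g(p))⁻¹ ≤ 2K` and the sifting product off `q` -/

/-- Under `HasSieveDimension g 1 K`: `(1 − g(p))⁻¹ ≤ 2K` for every prime `p` (the dimension
bound with `w = p`, `z = p + 1`, whose window contains exactly the prime `p`, and
`log (p+1) ≤ 2 log p`). [folklore] -/
theorem inv_one_sub_density_le {g : ArithmeticFunction ℝ} {K : ℝ} (hK : HasSieveDimension g 1 K)
    {p : ℕ} (hp : p.Prime) : (1 - g p)⁻¹ ≤ 2 * K := by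
  have hp2 : (2 : ℝ) ≤ p := by exact_mod_cast hp.two_le
  have h := hK.2 p (p + 1) hp2 (by linarith)
  have hset : (Nat.primesBelow ⌈((p : ℝ) + 1)⌉₊).filter (fun p' : ℕ => (p : ℝ) ≤ (p' : ℝ)) = {p} := by
    ext p'
    simp only [Finset.mem_filter, Nat.mem_primesBelow, Finset.mem_singleton]
    have hceil : ⌈((p : ℝ) + 1)⌉₊ = p + 1 := by exact_mod_cast Nat.ceil_natCast (p + 1)
    rw [hceil]
    constructor
    · rintro ⟨⟨hlt, -⟩, hle⟩
      have : p ≤ p' := by exact_mod_cast hle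
      omega
    · intro h'
      rw [h']
      exact ⟨⟨Nat.lt_succ_self p, hp⟩, le_rfl⟩
  rw [hset, Finset.prod_singleton, Real.rpow_one] at h
  refine h.trans ?_
  have hK1 : 1 ≤ K := hK.one_le
  have hlogp : 0 < Real.log p := Real.log_pos (by linarith)
  have hratio : Real.log ((p : ℝ) + 1) / Real.log p ≤ 2 := by
    rw [div_le_iff₀ hlogp]
    calc Real.log ((p : ℝ) + 1) ≤ Real.log ((p : ℝ) ^ 2) :=
          Real.log_le_log (by linarith) (by nlinarith)
      _ = 2 * Real.log p := by rw [Real.log_pow]; norm_num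
  calc K * (Real.log ((p : ℝ) + 1) / Real.log p) ≤ K * 2 :=
        mul_le_mul_of_nonneg_left hratio (by linarith)
    _ = 2 * K := mul_comm _ _

/-- **The sifting product off `q`**: for `g` with `HasSieveDimension g 1 K` and `q` with at most
`k` prime factors, `∏_{p < ζ, p ∤ q} (1 − g(p)) ≤ (2K)^k ∏_{p < ζ} (1 − g(p))`. [folklore] -/
theorem prod_primesBelow_not_dvd_le {g : ArithmeticFunction ℝ} {K : ℝ} (hK : HasSieveDimension g 1 K)
    {q k : ℕ} (hω : q.primeFactors.card ≤ k) (hq : q ≠ 0) (B : ℕ) :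
    ∏ p ∈ (Nat.primesBelow B).filter (fun p : ℕ => ¬ p ∣ q), (1 - g p) ≤
      (2 * K) ^ k * ∏ p ∈ Nat.primesBelow B, (1 - g p) := by
  have hK1 : 1 ≤ K := hK.one_le
  have h2K : 1 ≤ 2 * K := by linarith
  have hfac : ∀ p ∈ Nat.primesBelow B, 0 < 1 - g p := fun p hp =>
    sub_pos.mpr (hK.1 p (Nat.prime_of_mem_primesBelow hp)).2
  have hfac1 : ∀ p ∈ Nat.primesBelow B, 1 - g p ≤ 1 := fun p hp =>
    sub_le_self _ (hK.1 p (Nat.prime_of_mem_primesBelow hp)).1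
  -- split the full product into `p ∤ q` and `p ∣ q`
  rw [← Finset.prod_filter_mul_prod_filter_not (Nat.primesBelow B) (fun p : ℕ => ¬ p ∣ q)]
  set Pn := (Nat.primesBelow B).filter (fun p : ℕ => ¬ p ∣ q) with hPn
  set Pd := (Nat.primesBelow B).filter (fun p : ℕ => ¬ ¬ p ∣ q) with hPd
  have hPn0 : 0 ≤ ∏ p ∈ Pn, (1 - g p) :=
    Finset.prod_nonneg fun p hp => (hfac p (Finset.mem_filter.mp hp).1).le
  -- `∏_{p ∈ Pd} (1 - g p) ≥ (2K)^{-card Pd} ≥ (2K)^{-k}`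
  have hPd_card : Pd.card ≤ k := by
    refine le_trans (Finset.card_le_card ?_) hω
    intro p hp
    obtain ⟨hp', hpq⟩ := Finset.mem_filter.mp hp
    rw [not_not] at hpq
    exact Nat.mem_primeFactors.mpr ⟨Nat.prime_of_mem_primesBelow hp', hpq, hq⟩
  have hPd_lower : ((2 * K) ^ k)⁻¹ ≤ ∏ p ∈ Pd, (1 - g p) := by
    have h1 : ∀ p ∈ Pd, (2 * K)⁻¹ ≤ 1 - g p := by
      intro p hp
      have hp' := (Finset.mem_filter.mp hp).1
      have hpp := Nat.prime_of_mem_primesBelow hp'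
      exact inv_le_of_inv_le₀ (hfac p hp') (inv_one_sub_density_le hK hpp)
    calc ((2 * K) ^ k)⁻¹ ≤ ((2 * K) ^ Pd.card)⁻¹ := by
          rw [inv_le_inv₀ (by positivity) (by positivity)]
          exact pow_le_pow_right₀ h2K hPd_card
      _ = ∏ _p ∈ Pd, (2 * K)⁻¹ := by rw [Finset.prod_const, inv_pow]
      _ ≤ ∏ p ∈ Pd, (1 - g p) := Finset.prod_le_prod (fun _ _ => by positivity) h1
  calc ∏ p ∈ Pn, (1 - g p) = (∏ p ∈ Pn, (1 - g p)) * 1 := (mul_one _).symm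
    _ = (∏ p ∈ Pn, (1 - g p)) * ((2 * K) ^ k * ((2 * K) ^ k)⁻¹) := by
        rw [mul_inv_cancel₀ (by positivity)]
    _ = (2 * K) ^ k * ((∏ p ∈ Pn, (1 - g p)) * ((2 * K) ^ k)⁻¹) := by ring
    _ ≤ (2 * K) ^ k * ((∏ p ∈ Pn, (1 - g p)) * ∏ p ∈ Pd, (1 - g p)) :=
        mul_le_mul_of_nonneg_left (mul_le_mul_of_nonneg_left hPd_lower hPn0) (by positivity)

end BombieriSieve

end Literature.NumberTheory.Sieve

namespace Literature.NumberTheory.Sieve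

namespace BombieriSieve

open Finset ArithmeticFunction Filter
open scoped ArithmeticFunction.Moebius ArithmeticFunction.vonMangoldt Topology

/-! ### The prime-power sums `E_c(P) = ∑_{p<P} ∑_a (g(p^a) + g(p^{a+1})) (a log p)^c ≪ (log P)^c` -/

/-- A bounded-sequence constant: for `0 ≤ ρ < 1` and `k`, there is `M ≥ 0` with `a^k ρ^a ≤ M` for
all `a` (since `a^k ρ^a → 0`). [folklore] -/
theorem exists_pow_mul_geom_le (k : ℕ) {ρ : ℝ} (hρ0 : 0 ≤ ρ) (hρ1 : ρ < 1) :
    ∃ M : ℝ, 0 ≤ M ∧ ∀ a : ℕ, (a : ℝ) ^ k * ρ ^ a ≤ M := by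
  have ht := tendsto_pow_const_mul_const_pow_of_abs_lt_one k (show |ρ| < 1 by
    rwa [abs_of_nonneg hρ0])
  have hb : BddAbove (Set.range fun a : ℕ => (a : ℝ) ^ k * ρ ^ a) := by
    rw [← Nat.cofinite_eq_atTop] at ht
    exact ht.bddAbove_range_of_cofinite
  obtain ⟨M, hM⟩ := hb
  refine ⟨max M 0, le_max_right _ _, fun a => (hM ⟨a, rfl⟩).trans (le_max_left _ _)⟩

/-- **`E_c(P) ≪ (log P)^c`** for the weights `W(p, a) = g(p^a) + g(p^{a+1})` of a Bombieri density
with `g ≥ 0`: for `1 ≤ c ≤ k`, `2 ≤ P` and any `X`,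
`∑_{p<P} ∑_{1 ≤ a ≤ log₂ X} (g(p^a) + g(p^{a+1})) (a log p)^c ≤ C_E (log P)^c`, with `C_E`
depending on the sequence and `k` only. Inputs: (A₁) with `ε = ¼` (`g(d) ≤ C₁ d^{−3/4}`, so the
prime powers `a ≥ 2` and the squares contribute `O((log P)^c)` by comparison with `∑ n^{−3/2}`),
`∑_p |g(p) − 1/p| < ∞` (`summable_prime_density_sub_inv`, from (A₅)) and Mertens'
`∑_{p ≤ P} log p/p ≤ log P + log 4` (`MertensBound.sum_log_div_prime_le`). [folklore] -/
theorem primePow_weight_sum_le (A : SieveSequence) (h1 : A.BombieriA1) (h5 : A.BombieriA5)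
    (hg0 : ∀ d, 1 ≤ d → 0 ≤ A.density d) (k : ℕ) :
    ∃ CE : ℝ, 0 ≤ CE ∧ ∀ (P X c : ℕ), 2 ≤ P → 1 ≤ c → c ≤ k →
      ∑ p ∈ Nat.primesBelow P, ∑ a ∈ Finset.Icc 1 (Nat.log 2 X),
        (A.density (p ^ a) + A.density (p ^ (a + 1))) * ((a : ℝ) * Real.log p) ^ c ≤
          CE * Real.log P ^ c := by
  -- (A₁) with `ε = 1/4`
  obtain ⟨C₁, hC₁⟩ := h1.1 (1 / 4) (by norm_num)
  have hC : ∀ d : ℕ, 1 ≤ d → A.density d ≤ C₁ * ((d : ℝ) ^ (3 / 4 : ℝ))⁻¹ := by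
    intro d hd
    have h := (le_abs_self _).trans (hC₁ d hd)
    rwa [show (-1 + 1 / 4 : ℝ) = -(3 / 4) by norm_num, Real.rpow_neg (Nat.cast_nonneg d)] at h
  have hC0 : 0 ≤ C₁ := by
    have := (abs_nonneg _).trans (hC₁ 1 le_rfl)
    simpa using this
  -- `S₀ = ∑_p |g(p) − 1/p|`
  have hS := summable_prime_density_sub_inv A h1 h5
  set S₀ := ∑' n : ℕ, (if n.Prime then |A.density n - (n : ℝ)⁻¹| else 0) with hS₀
  have hS₀0 : 0 ≤ S₀ := tsum_nonneg fun n => by split_ifs <;> positivity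
  -- `Z = ∑_n n^{-3/2}`
  have hZs : Summable (fun n : ℕ => (n : ℝ) ^ (-(3 / 2 : ℝ))) :=
    Real.summable_nat_rpow.mpr (by norm_num)
  set Z := ∑' n : ℕ, (n : ℝ) ^ (-(3 / 2 : ℝ)) with hZ
  have hZ0 : 0 ≤ Z := tsum_nonneg fun n => Real.rpow_nonneg (Nat.cast_nonneg n) _
  -- `ρ = 2^{-3/8}`, `ρ² = 2^{-3/4}`
  set ρ : ℝ := ((2 : ℝ) ^ (3 / 8 : ℝ))⁻¹ with hρ
  have h2pos : (0 : ℝ) < (2 : ℝ) ^ (3 / 8 : ℝ) := Real.rpow_pos_of_pos two_pos _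
  have hρ0 : 0 < ρ := inv_pos.mpr h2pos
  have hρ1 : ρ < 1 := inv_lt_one_of_one_lt₀ (Real.one_lt_rpow one_lt_two (by norm_num))
  obtain ⟨M, hM0, hM⟩ := exists_pow_mul_geom_le k hρ0.le hρ1
  -- the constant
  set Cii := 2 * C₁ * (ρ ^ 4)⁻¹ * M * ρ ^ 2 / (1 - ρ) with hCii
  have hCii0 : 0 ≤ Cii := by
    rw [hCii]
    exact div_nonneg (by positivity) (by linarith)
  refine ⟨1 + S₀ + Real.log 4 / Real.log 2 + C₁ * Z + Cii * Z, by positivity, ?_⟩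
  intro P X c hP hc1 hck
  set Lp := Real.log P with hLp
  have hlog2 : 0 < Real.log 2 := Real.log_pos one_lt_two
  have hlog4 : 0 ≤ Real.log 4 := Real.log_nonneg (by norm_num)
  have hLp2 : Real.log 2 ≤ Lp := Real.log_le_log two_pos (by exact_mod_cast hP)
  have hLp0 : 0 < Lp := hlog2.trans_le hLp2
  -- facts about primes `p < P`
  have hprime : ∀ p ∈ Nat.primesBelow P, p.Prime ∧ (2 : ℝ) ≤ p ∧ 0 < Real.log p ∧ Real.log p ≤ Lp := by
    intro p hp
    obtain ⟨hpP, hpp⟩ := Nat.mem_primesBelow.mp hp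
    have h2 : (2 : ℝ) ≤ p := by exact_mod_cast hpp.two_le
    exact ⟨hpp, h2, Real.log_pos (by linarith), Real.log_le_log (by linarith) (by exact_mod_cast hpP.le)⟩
  -- `t p = p^{-3/4}`, `g(p^a) ≤ C₁ (t p)^a`, `t p ≤ ρ²`, `(t p)² = p^{-3/2}`
  set t : ℕ → ℝ := fun p => ((p : ℝ) ^ (3 / 4 : ℝ))⁻¹ with ht
  have htpow : ∀ p a : ℕ, (((p ^ a : ℕ) : ℝ) ^ (3 / 4 : ℝ))⁻¹ = t p ^ a := by
    intro p a
    simp only [ht]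
    rw [Nat.cast_pow, ← Real.rpow_natCast_mul (Nat.cast_nonneg p), mul_comm,
      Real.rpow_mul_natCast (Nat.cast_nonneg p), inv_pow]
  have hgt : ∀ p a : ℕ, 1 ≤ p → A.density (p ^ a) ≤ C₁ * t p ^ a := by
    intro p a hp
    have := hC (p ^ a) (Nat.one_le_pow _ _ hp)
    rwa [htpow] at this
  have ht0 : ∀ p : ℕ, 1 ≤ p → 0 < t p := fun p hp =>
    inv_pos.mpr (Real.rpow_pos_of_pos (by exact_mod_cast hp) _)
  have hρ2 : ρ ^ 2 = ((2 : ℝ) ^ (3 / 4 : ℝ))⁻¹ := by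
    rw [hρ, inv_pow, ← Real.rpow_mul_natCast zero_le_two]; norm_num
  have htρ : ∀ p : ℕ, (2 : ℝ) ≤ p → t p ≤ ρ ^ 2 := by
    intro p hp
    rw [hρ2]
    exact inv_anti₀ (Real.rpow_pos_of_pos two_pos _)
      (Real.rpow_le_rpow zero_le_two hp (by norm_num))
  have hρ21 : ρ ^ 2 ≤ 1 := by nlinarith
  have ht2 : ∀ p : ℕ, t p ^ 2 = (p : ℝ) ^ (-(3 / 2 : ℝ)) := by
    intro p
    simp only [ht]
    rw [inv_pow, ← Real.rpow_mul_natCast (Nat.cast_nonneg p), Real.rpow_neg (Nat.cast_nonneg p)]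
    norm_num
  -- `∑_{p<P} p^{-3/2} ≤ Z`
  have hsumZ : ∑ p ∈ Nat.primesBelow P, (p : ℝ) ^ (-(3 / 2 : ℝ)) ≤ Z := by
    calc ∑ p ∈ Nat.primesBelow P, (p : ℝ) ^ (-(3 / 2 : ℝ))
        ≤ ∑ p ∈ Finset.range P, (p : ℝ) ^ (-(3 / 2 : ℝ)) :=
          Finset.sum_le_sum_of_subset_of_nonneg (Finset.filter_subset _ _)
            fun p _ _ => Real.rpow_nonneg (Nat.cast_nonneg p) _
      _ ≤ Z := hZs.sum_le_tsum _ fun p _ => Real.rpow_nonneg (Nat.cast_nonneg p) _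
  -- `∑_{p<P} |g(p) − 1/p| ≤ S₀`
  have hsumS : ∑ p ∈ Nat.primesBelow P, |A.density p - (p : ℝ)⁻¹| ≤ S₀ := by
    calc ∑ p ∈ Nat.primesBelow P, |A.density p - (p : ℝ)⁻¹|
        = ∑ p ∈ Nat.primesBelow P, (if p.Prime then |A.density p - (p : ℝ)⁻¹| else 0) :=
          Finset.sum_congr rfl fun p hp => by rw [if_pos (Nat.prime_of_mem_primesBelow hp)]
      _ ≤ ∑ p ∈ Finset.range P, (if p.Prime then |A.density p - (p : ℝ)⁻¹| else 0) :=
          Finset.sum_le_sum_of_subset_of_nonneg (Finset.filter_subset _ _)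
            fun p _ _ => by split_ifs <;> positivity
      _ ≤ S₀ := hS.sum_le_tsum _ fun p _ => by split_ifs <;> positivity
  -- Mertens: `∑_{p<P} log p / p ≤ log P + log 4`
  have hMertens : ∑ p ∈ Nat.primesBelow P, Real.log p / p ≤ Lp + Real.log 4 := by
    refine le_trans (Finset.sum_le_sum_of_subset_of_nonneg ?_ fun p hp _ => ?_)
      (LFunctions.MertensBound.sum_log_div_prime_le P)
    · intro p hp
      rw [Nat.mem_primesBelow] at hp
      exact Nat.mem_primesLE.mpr ⟨hp.1.le, hp.2⟩
    · exact div_nonneg (Real.log_natCast_nonneg p) (Nat.cast_nonneg p)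
  -- nonnegativity of the summands
  have hnn : ∀ p ∈ Nat.primesBelow P, ∀ a : ℕ,
      0 ≤ (A.density (p ^ a) + A.density (p ^ (a + 1))) * ((a : ℝ) * Real.log p) ^ c := by
    intro p hp a
    obtain ⟨hpp, -, -, -⟩ := hprime p hp
    exact mul_nonneg (add_nonneg (hg0 _ (Nat.one_le_pow _ _ hpp.pos))
      (hg0 _ (Nat.one_le_pow _ _ hpp.pos)))
      (pow_nonneg (mul_nonneg (Nat.cast_nonneg a) (Real.log_natCast_nonneg p)) _)
  -- split `a = 1` and `a ≥ 2`
  have hsplit : ∀ p ∈ Nat.primesBelow P, ∑ a ∈ Finset.Icc 1 (Nat.log 2 X),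
      (A.density (p ^ a) + A.density (p ^ (a + 1))) * ((a : ℝ) * Real.log p) ^ c ≤
      (A.density p * Real.log p ^ c + A.density (p ^ 2) * Real.log p ^ c) +
        ∑ a ∈ Finset.Icc 2 (Nat.log 2 X),
          (A.density (p ^ a) + A.density (p ^ (a + 1))) * ((a : ℝ) * Real.log p) ^ c := by
    intro p hp
    have hsub : Finset.Icc 1 (Nat.log 2 X) ⊆ insert 1 (Finset.Icc 2 (Nat.log 2 X)) := by
      intro a ha
      rw [Finset.mem_Icc] at ha
      rw [Finset.mem_insert, Finset.mem_Icc]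
      omega
    refine (Finset.sum_le_sum_of_subset_of_nonneg hsub fun a _ _ => hnn p hp a).trans ?_
    rw [Finset.sum_insert (by simp), pow_one, Nat.cast_one, one_mul, add_mul]
  -- the `a = 1` part
  have hA1 : ∀ p ∈ Nat.primesBelow P,
      A.density p * Real.log p ^ c + A.density (p ^ 2) * Real.log p ^ c ≤
        Lp ^ (c - 1) * (Real.log p / p + |A.density p - (p : ℝ)⁻¹| * Lp) +
          Lp ^ c * (C₁ * (p : ℝ) ^ (-(3 / 2 : ℝ))) := by
    intro p hp
    obtain ⟨hpp, hp2, hlp0, hlpL⟩ := hprime p hp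
    have hgp : 0 ≤ A.density p := hg0 p hpp.pos
    have hlpc : Real.log p ^ c ≤ Lp ^ c := pow_le_pow_left₀ hlp0.le hlpL c
    have e1 : A.density p * Real.log p ^ c ≤
        Lp ^ (c - 1) * (Real.log p / p + |A.density p - (p : ℝ)⁻¹| * Lp) := by
      obtain ⟨c', rfl⟩ : ∃ c', c = c' + 1 := ⟨c - 1, by omega⟩
      rw [Nat.add_sub_cancel, pow_succ]
      have h3 : A.density p ≤ (p : ℝ)⁻¹ + |A.density p - (p : ℝ)⁻¹| := by
        linarith [le_abs_self (A.density p - (p : ℝ)⁻¹)]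
      have h2 : A.density p * Real.log p ≤ Real.log p / p + |A.density p - (p : ℝ)⁻¹| * Lp := by
        calc A.density p * Real.log p ≤ ((p : ℝ)⁻¹ + |A.density p - (p : ℝ)⁻¹|) * Real.log p :=
              mul_le_mul_of_nonneg_right h3 hlp0.le
          _ = Real.log p / p + |A.density p - (p : ℝ)⁻¹| * Real.log p := by ring
          _ ≤ Real.log p / p + |A.density p - (p : ℝ)⁻¹| * Lp := by gcongr
      calc A.density p * (Real.log p ^ c' * Real.log p)
          = Real.log p ^ c' * (A.density p * Real.log p) := by ring
        _ ≤ Lp ^ c' * (Real.log p / p + |A.density p - (p : ℝ)⁻¹| * Lp) :=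
            mul_le_mul (pow_le_pow_left₀ hlp0.le hlpL c') h2 (mul_nonneg hgp hlp0.le)
              (pow_nonneg hLp0.le _)
    have e2 : A.density (p ^ 2) * Real.log p ^ c ≤ Lp ^ c * (C₁ * (p : ℝ) ^ (-(3 / 2 : ℝ))) := by
      have := hgt p 2 hpp.pos
      rw [ht2] at this
      calc A.density (p ^ 2) * Real.log p ^ c ≤ (C₁ * (p : ℝ) ^ (-(3 / 2 : ℝ))) * Lp ^ c :=
            mul_le_mul this hlpc (pow_nonneg hlp0.le _) (by positivity)
        _ = Lp ^ c * (C₁ * (p : ℝ) ^ (-(3 / 2 : ℝ))) := mul_comm _ _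
    exact add_le_add e1 e2
  -- the `a ≥ 2` part
  have hA2 : ∀ p ∈ Nat.primesBelow P, ∑ a ∈ Finset.Icc 2 (Nat.log 2 X),
      (A.density (p ^ a) + A.density (p ^ (a + 1))) * ((a : ℝ) * Real.log p) ^ c ≤
        Lp ^ c * (Cii * (p : ℝ) ^ (-(3 / 2 : ℝ))) := by
    intro p hp
    obtain ⟨hpp, hp2, hlp0, hlpL⟩ := hprime p hp
    have htp0 := ht0 p hpp.pos
    have htpρ := htρ p hp2
    set D₀ := Lp ^ c * (2 * C₁ * (ρ ^ 4)⁻¹ * M * (p : ℝ) ^ (-(3 / 2 : ℝ))) with hD₀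
    have hD₀0 : 0 ≤ D₀ := by positivity
    -- termwise: `term(a) ≤ D₀ ρ^a`
    have hterm : ∀ a ∈ Finset.Icc 2 (Nat.log 2 X),
        (A.density (p ^ a) + A.density (p ^ (a + 1))) * ((a : ℝ) * Real.log p) ^ c ≤ D₀ * ρ ^ a := by
      intro a ha
      have ha2 : 2 ≤ a := (Finset.mem_Icc.mp ha).1
      have ha1 : (1 : ℝ) ≤ a := by exact_mod_cast (show 1 ≤ a by omega)
      have hg2 : A.density (p ^ a) + A.density (p ^ (a + 1)) ≤ 2 * C₁ * t p ^ a := by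
        have h1 := hgt p a hpp.pos
        have h2 := hgt p (a + 1) hpp.pos
        have h3 : t p ^ (a + 1) ≤ t p ^ a := by
          rw [pow_succ]
          exact mul_le_of_le_one_right (pow_nonneg htp0.le _) (htpρ.trans hρ21)
        nlinarith
      have hal : ((a : ℝ) * Real.log p) ^ c ≤ (a : ℝ) ^ k * Lp ^ c := by
        rw [mul_pow]
        exact mul_le_mul (pow_le_pow_right₀ ha1 hck) (pow_le_pow_left₀ hlp0.le hlpL c)
          (pow_nonneg hlp0.le _) (by positivity)
      have htpa : t p ^ a ≤ (p : ℝ) ^ (-(3 / 2 : ℝ)) * (ρ ^ 2) ^ (a - 2) := by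
        rw [← ht2, show a = 2 + (a - 2) from by omega, pow_add, Nat.add_sub_cancel_left]
        exact mul_le_mul_of_nonneg_left (pow_le_pow_left₀ htp0.le htpρ _) (pow_nonneg htp0.le _)
      have hkey : (ρ ^ 2) ^ (a - 2) * (a : ℝ) ^ k ≤ (ρ ^ 4)⁻¹ * M * ρ ^ a := by
        have hρ4 : 0 < ρ ^ 4 := pow_pos hρ0 4
        have hid : (ρ ^ 2) ^ (a - 2) * ρ ^ 4 = ρ ^ a * ρ ^ a := by
          rw [← pow_mul, ← pow_add, ← pow_add]
          congr 1
          omega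
        have h1 : (ρ ^ 2) ^ (a - 2) = ρ ^ a * ρ ^ a * (ρ ^ 4)⁻¹ := by
          rw [← hid, mul_assoc, mul_inv_cancel₀ hρ4.ne', mul_one]
        rw [h1]
        calc ρ ^ a * ρ ^ a * (ρ ^ 4)⁻¹ * (a : ℝ) ^ k = (ρ ^ 4)⁻¹ * ((a : ℝ) ^ k * ρ ^ a) * ρ ^ a := by
              ring
          _ ≤ (ρ ^ 4)⁻¹ * M * ρ ^ a :=
              mul_le_mul_of_nonneg_right (mul_le_mul_of_nonneg_left (hM a) (by positivity))
                (pow_nonneg hρ0.le _)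
      calc (A.density (p ^ a) + A.density (p ^ (a + 1))) * ((a : ℝ) * Real.log p) ^ c
          ≤ (2 * C₁ * t p ^ a) * ((a : ℝ) ^ k * Lp ^ c) :=
            mul_le_mul hg2 hal (pow_nonneg (mul_nonneg (Nat.cast_nonneg a) hlp0.le) _)
              (by positivity)
        _ ≤ (2 * C₁ * ((p : ℝ) ^ (-(3 / 2 : ℝ)) * (ρ ^ 2) ^ (a - 2))) * ((a : ℝ) ^ k * Lp ^ c) := by
            gcongr
        _ = Lp ^ c * (2 * C₁ * (p : ℝ) ^ (-(3 / 2 : ℝ))) * ((ρ ^ 2) ^ (a - 2) * (a : ℝ) ^ k) := by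
            ring
        _ ≤ Lp ^ c * (2 * C₁ * (p : ℝ) ^ (-(3 / 2 : ℝ))) * ((ρ ^ 4)⁻¹ * M * ρ ^ a) :=
            mul_le_mul_of_nonneg_left hkey (by positivity)
        _ = D₀ * ρ ^ a := by rw [hD₀]; ring
    -- sum the geometric series
    have hgeom : ∑ a ∈ Finset.Icc 2 (Nat.log 2 X), ρ ^ a ≤ ρ ^ 2 / (1 - ρ) := by
      rw [← Finset.Ico_add_one_right_eq_Icc]
      exact geom_sum_Ico_le_of_lt_one hρ0.le hρ1
    calc ∑ a ∈ Finset.Icc 2 (Nat.log 2 X),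
          (A.density (p ^ a) + A.density (p ^ (a + 1))) * ((a : ℝ) * Real.log p) ^ c
        ≤ ∑ a ∈ Finset.Icc 2 (Nat.log 2 X), D₀ * ρ ^ a := Finset.sum_le_sum hterm
      _ = D₀ * ∑ a ∈ Finset.Icc 2 (Nat.log 2 X), ρ ^ a := (Finset.mul_sum _ _ _).symm
      _ ≤ D₀ * (ρ ^ 2 / (1 - ρ)) := mul_le_mul_of_nonneg_left hgeom hD₀0
      _ = Lp ^ c * (Cii * (p : ℝ) ^ (-(3 / 2 : ℝ))) := by
          rw [hD₀, hCii]
          field_simp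
  -- assemble
  have htot : ∀ p ∈ Nat.primesBelow P, ∑ a ∈ Finset.Icc 1 (Nat.log 2 X),
      (A.density (p ^ a) + A.density (p ^ (a + 1))) * ((a : ℝ) * Real.log p) ^ c ≤
      Lp ^ (c - 1) * (Real.log p / p + |A.density p - (p : ℝ)⁻¹| * Lp) +
        Lp ^ c * ((C₁ + Cii) * (p : ℝ) ^ (-(3 / 2 : ℝ))) := by
    intro p hp
    refine (hsplit p hp).trans ?_
    have := add_le_add (hA1 p hp) (hA2 p hp)
    linarith
  refine (Finset.sum_le_sum htot).trans ?_
  rw [Finset.sum_add_distrib, ← Finset.mul_sum, ← Finset.mul_sum, Finset.sum_add_distrib,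
    ← Finset.sum_mul, ← Finset.mul_sum]
  have hc' : Lp ^ (c - 1) * Real.log 2 ≤ Lp ^ c := by
    obtain ⟨c', rfl⟩ : ∃ c', c = c' + 1 := ⟨c - 1, by omega⟩
    rw [Nat.add_sub_cancel, pow_succ]
    exact mul_le_mul_of_nonneg_left hLp2 (pow_nonneg hLp0.le _)
  have hLc1 : Lp ^ (c - 1) ≤ Lp ^ c / Real.log 2 := by
    rw [le_div_iff₀ hlog2]; exact hc'
  have hLc0 : 0 ≤ Lp ^ (c - 1) := pow_nonneg hLp0.le _
  calc Lp ^ (c - 1) * (∑ p ∈ Nat.primesBelow P, Real.log p / p +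
          (∑ p ∈ Nat.primesBelow P, |A.density p - (p : ℝ)⁻¹|) * Lp) +
        Lp ^ c * ((C₁ + Cii) * ∑ p ∈ Nat.primesBelow P, (p : ℝ) ^ (-(3 / 2 : ℝ)))
      ≤ Lp ^ (c - 1) * ((Lp + Real.log 4) + S₀ * Lp) + Lp ^ c * ((C₁ + Cii) * Z) := by
        gcongr
    _ = Lp ^ (c - 1) * Lp * (1 + S₀) + Lp ^ (c - 1) * Real.log 4 + Lp ^ c * ((C₁ + Cii) * Z) := by
        ring
    _ ≤ Lp ^ c * (1 + S₀) + (Lp ^ c / Real.log 2) * Real.log 4 + Lp ^ c * ((C₁ + Cii) * Z) := by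
        have h1 : Lp ^ (c - 1) * Lp = Lp ^ c := by
          obtain ⟨c', rfl⟩ : ∃ c', c = c' + 1 := ⟨c - 1, by omega⟩
          rw [Nat.add_sub_cancel, pow_succ]
        rw [h1]
        gcongr
    _ = (1 + S₀ + Real.log 4 / Real.log 2 + C₁ * Z + Cii * Z) * Lp ^ c := by
        field_simp
        ring

end BombieriSieve

end Literature.NumberTheory.Sieve

namespace Literature.NumberTheory.Sieve

namespace BombieriSieve

open Finset ArithmeticFunction Filter
open scoped ArithmeticFunction.Moebius ArithmeticFunction.vonMangoldt Topology

/-! ### The sifted sequence `C_q = (a_{qr} 1_{(r,q)=1})_r` -/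

/-- Möbius detects coprimality: `∑_{e ∣ q} μ(e) [e ∣ r] = [(r, q) = 1]` (`q ≠ 0`). [folklore] -/
theorem sum_divisors_moebius_mul_indicator_dvd {q : ℕ} (hq : q ≠ 0) (r : ℕ) :
    ∑ e ∈ q.divisors, (μ e : ℝ) * (if e ∣ r then 1 else 0) =
      if r.Coprime q then 1 else 0 := by
  classical
  rw [← Finset.sum_filter_of_ne (p := fun e => e ∣ r) (fun e _ h => by
    by_contra hnd; rw [if_neg hnd, mul_zero] at h; exact h rfl)]
  have hset : q.divisors.filter (fun e : ℕ => e ∣ r) = (Nat.gcd r q).divisors := by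
    ext e
    simp only [Finset.mem_filter, Nat.mem_divisors, Nat.dvd_gcd_iff]
    constructor
    · rintro ⟨⟨heq, -⟩, her⟩
      exact ⟨⟨her, heq⟩, Nat.gcd_ne_zero_right hq⟩
    · rintro ⟨⟨her, heq⟩, -⟩
      exact ⟨⟨heq, hq⟩, her⟩
  rw [hset]
  have h2 : ∑ e ∈ (Nat.gcd r q).divisors, (μ e : ℝ) * (if e ∣ r then 1 else 0) =
      ∑ e ∈ (Nat.gcd r q).divisors, (μ e : ℝ) :=
    Finset.sum_congr rfl fun e he => by
      rw [if_pos ((Nat.dvd_of_mem_divisors he).trans (Nat.gcd_dvd_left r q)), mul_one]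
  rw [h2, sum_divisors_moebius_real]

/-- **Congruence sums of `C_q` by Möbius inversion**: for `q ≠ 0` and `(d, q) = 1`,
`∑_{r ≤ x/q, d ∣ r, (r,q)=1} a_{qr} = ∑_{e ∣ q} μ(e) A(x; qed)`. [folklore] -/
theorem sum_coprime_dvd_eq_sum_moebius_congrSum (A : SieveSequence) {q d : ℕ} (hq : q ≠ 0)
    (hdq : d.Coprime q) (x : ℝ) :
    ∑ r ∈ (Ioc 0 ⌊x / q⌋₊).filter (fun r : ℕ => d ∣ r ∧ r.Coprime q), A.a (q * r) =
      ∑ e ∈ q.divisors, (μ e : ℝ) * A.congrSum (q * e * d) x := by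
  classical
  have hq0 : 0 < q := Nat.pos_of_ne_zero hq
  set X' := ⌊x / q⌋₊ with hX'
  -- insert the Möbius indicator
  have h1 : ∑ r ∈ (Ioc 0 X').filter (fun r : ℕ => d ∣ r ∧ r.Coprime q), A.a (q * r) =
      ∑ r ∈ (Ioc 0 X').filter (fun r : ℕ => d ∣ r),
        A.a (q * r) * ∑ e ∈ q.divisors, (μ e : ℝ) * (if e ∣ r then 1 else 0) := by
    rw [← Finset.filter_filter, Finset.sum_filter]
    refine Finset.sum_congr rfl fun r _ => ?_
    rw [sum_divisors_moebius_mul_indicator_dvd hq]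
    split_ifs <;> simp
  rw [h1]
  -- interchange
  simp_rw [Finset.mul_sum]
  rw [Finset.sum_comm]
  refine Finset.sum_congr rfl fun e he => ?_
  have heq : e ∣ q := Nat.dvd_of_mem_divisors he
  have hde : d.Coprime e := hdq.coprime_dvd_right heq
  -- `∑_{r, d ∣ r} a_{qr} μ(e) [e ∣ r] = μ(e) ∑_{r, de ∣ r} a_{qr}`
  have h2 : ∑ r ∈ (Ioc 0 X').filter (fun r : ℕ => d ∣ r),
      A.a (q * r) * ((μ e : ℝ) * (if e ∣ r then 1 else 0)) =
      (μ e : ℝ) * ∑ r ∈ (Ioc 0 X').filter (fun r : ℕ => e * d ∣ r), A.a (q * r) := by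
    rw [Finset.mul_sum, Finset.sum_filter, Finset.sum_filter]
    refine Finset.sum_congr rfl fun r _ => ?_
    by_cases hdr : d ∣ r
    · by_cases her : e ∣ r
      · rw [if_pos hdr, if_pos her, if_pos (hde.symm.mul_dvd_of_dvd_of_dvd her hdr)]; ring
      · rw [if_pos hdr, if_neg her, if_neg (fun h => her ((dvd_mul_right e d).trans h))]; ring
    · rw [if_neg hdr, if_neg (fun h => hdr ((dvd_mul_left d e).trans h))]
  rw [h2]
  congr 1
  -- `∑_{r ≤ ⌊x/q⌋, ed ∣ r} a_{qr} = A(x; qed)` via `n = qr`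
  rw [SieveSequence.congrSum]
  refine Finset.sum_nbij' (fun r => q * r) (fun n => n / q) ?_ ?_ ?_ ?_ ?_
  · intro r hr
    obtain ⟨hr', hedr⟩ := Finset.mem_filter.mp hr
    obtain ⟨hr0, hrX⟩ := Finset.mem_Ioc.mp hr'
    refine Finset.mem_filter.mpr ⟨Finset.mem_Ioc.mpr ⟨Nat.mul_pos hq0 hr0, ?_⟩, ?_⟩
    · rw [hX', Nat.floor_div_natCast] at hrX
      rw [mul_comm]
      exact (Nat.le_div_iff_mul_le hq0).mp hrX
    · rw [mul_assoc]
      exact Nat.mul_dvd_mul_left q hedr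
  · intro n hn
    obtain ⟨hn', hqn⟩ := Finset.mem_filter.mp hn
    obtain ⟨hn0, hnX⟩ := Finset.mem_Ioc.mp hn'
    have hqn' : q ∣ n := (dvd_mul_right q (e * d)).trans (mul_assoc q e d ▸ hqn)
    refine Finset.mem_filter.mpr ⟨Finset.mem_Ioc.mpr ⟨Nat.div_pos (Nat.le_of_dvd hn0 hqn') hq0, ?_⟩, ?_⟩
    · rw [hX', Nat.floor_div_natCast]
      exact Nat.div_le_div_right hnX
    · obtain ⟨m, rfl⟩ := hqn'
      rw [Nat.mul_div_cancel_left m hq0]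
      rw [mul_assoc] at hqn
      exact Nat.dvd_of_mul_dvd_mul_left hq0 hqn
  · intro r _
    exact Nat.mul_div_cancel_left r hq0
  · intro n hn
    obtain ⟨-, hqn⟩ := Finset.mem_filter.mp hn
    have hqn' : q ∣ n := (dvd_mul_right q (e * d)).trans (mul_assoc q e d ▸ hqn)
    exact Nat.mul_div_cancel' hqn'
  · intro r _
    rfl

/-- The sifted sequence `C_q`: weights `a_{qr} 1_{(r,q)=1}`, size `g♭(q) A(x₀)` (a constant: the
height `x₀` is fixed), density `g` off `q` and `0` on the primes dividing `q`. Built as an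
anonymous structure inside proofs; this lemma packages the FL consequence. For `q ≠ 0` with at most
`k` prime factors, `g♭(q) ≥ 0`, `X(x₀) ≥ 0`, `HasSieveDimension g 1 K`, the fundamental lemma (constant
`C_F`) at `(ζ, D)` with `2 ≤ ζ ≤ D` gives
`∑_{r ≤ x₀/q, (r, P(ζ)) = 1, (r,q)=1} a_{qr} ≤ (1 + C_F) g♭(q) A(x₀) (2K)^k V(ζ)
   + ∑_{d ∣ P(ζ), d ≤ D, (d,q)=1} ∑_{e ∣ q} |μ(e)| |R(x₀; qed)|`.
[cite: FriedlanderIwaniecPisa1978, Lemma 19 (in the form used for Lemma 24)] -/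
theorem sifted_subsequence_le {K CF : ℝ}
    (hFL' : ∀ A : SieveSequence, HasSieveDimension A.density 1 K → ∀ x z D : ℝ, 2 ≤ z → z ≤ D →
      0 ≤ A.size x →
        |A.sifted x (primesProdBelow z) - A.size x * A.densityProduct (primesProdBelow z)| ≤
          CF * A.size x * A.densityProduct (primesProdBelow z) *
              Real.exp (-(Real.log D / Real.log z)) +
            ∑ d ∈ (primesProdBelow z).divisors.filter (fun d : ℕ => (d : ℝ) ≤ D),
              |A.remainder d x|)
    (hCF : 0 ≤ CF) (A : SieveSequence) (hK : HasSieveDimension A.density 1 K)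
    {q k : ℕ} (hq : q ≠ 0) (hω : q.primeFactors.card ≤ k)
    (hflat : 0 ≤ ∑ e ∈ q.divisors, (μ e : ℝ) * A.density (q * e)) {x₀ : ℝ}
    (hA0 : 0 ≤ A.size x₀) {ζ D : ℝ} (hζ : 2 ≤ ζ) (hζD : ζ ≤ D) :
    ∑ r ∈ (Ioc 0 ⌊x₀ / q⌋₊).filter
        (fun r : ℕ => r.Coprime (primesProdBelow ζ) ∧ r.Coprime q), A.a (q * r) ≤
      (1 + CF) * ((∑ e ∈ q.divisors, (μ e : ℝ) * A.density (q * e)) * A.size x₀) *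
          ((2 * K) ^ k * A.densityProduct (primesProdBelow ζ)) +
        ∑ d ∈ (primesProdBelow ζ).divisors.filter (fun d : ℕ => (d : ℝ) ≤ D ∧ d.Coprime q),
          ∑ e ∈ q.divisors, |(μ e : ℝ)| * |A.remainder (q * e * d) x₀| := by
  classical
  set gflat := ∑ e ∈ q.divisors, (μ e : ℝ) * A.density (q * e) with hgflat
  set P := primesProdBelow ζ with hP
  -- the density of `C_q`
  set gq : ArithmeticFunction ℝ :=
    ⟨fun d => if d.Coprime q then A.density d else 0, by
      show (if (0 : ℕ).Coprime q then A.density 0 else 0) = 0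
      split_ifs <;> simp [ArithmeticFunction.map_zero]⟩ with hgq
  have hgq_apply : ∀ d, gq d = if d.Coprime q then A.density d else 0 := fun d => rfl
  have hgq_mult : gq.IsMultiplicative := by
    refine ⟨?_, ?_⟩
    · rw [hgq_apply, if_pos (Nat.coprime_one_left q), A.density_mult.map_one]
    · intro m n hmn
      rw [hgq_apply, hgq_apply, hgq_apply]
      by_cases hm : m.Coprime q
      · by_cases hn : n.Coprime q
        · rw [if_pos (Nat.Coprime.mul_left hm hn), if_pos hm, if_pos hn,
            A.density_mult.map_mul_of_coprime hmn]
        · rw [if_neg (fun h => hn (Nat.Coprime.coprime_mul_left h)), if_neg hn, mul_zero]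
      · rw [if_neg (fun h => hm (Nat.Coprime.coprime_mul_right h)), if_neg hm, zero_mul]
  set Cq : SieveSequence :=
    { a := fun r => if r.Coprime q then A.a (q * r) else 0
      a_nonneg := fun r => by split_ifs; exacts [A.a_nonneg _, le_rfl]
      size := fun _ => gflat * A.size x₀
      density := gq
      density_mult := hgq_mult } with hCq
  -- dimension
  have hKq : HasSieveDimension Cq.density 1 K := by
    refine ⟨fun p hp => ?_, fun w z hw hwz => le_trans ?_ (hK.2 w z hw hwz)⟩
    · show 0 ≤ gq p ∧ gq p < 1
      rw [hgq_apply]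
      split_ifs
      · exact hK.1 p hp
      · exact ⟨le_rfl, zero_lt_one⟩
    · refine Finset.prod_le_prod (fun p hp => inv_nonneg.mpr (sub_nonneg.mpr ?_)) fun p hp => ?_
      · show gq p ≤ 1
        rw [hgq_apply]
        split_ifs
        · exact (hK.1 p (Nat.prime_of_mem_primesBelow (Finset.mem_filter.mp hp).1)).2.le
        · exact zero_le_one
      · have hpp := Nat.prime_of_mem_primesBelow (Finset.mem_filter.mp hp).1
        show (1 - gq p)⁻¹ ≤ (1 - A.density p)⁻¹
        rw [hgq_apply]
        split_ifs
        · exact le_rfl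
        · rw [sub_zero, inv_one, one_le_inv_iff₀]
          exact ⟨sub_pos.mpr (hK.1 p hpp).2, sub_le_self _ (hK.1 p hpp).1⟩
  have hsize : Cq.size (x₀ / q) = gflat * A.size x₀ := rfl
  have hdens : Cq.densityProduct P = ∏ p ∈ Nat.primesBelow ⌈ζ⌉₊, (1 - gq p) := by
    rw [SieveSequence.densityProduct, hP, primeFactors_primesProdBelow]
  -- `V_q ≤ (2K)^k V`
  have hVq : Cq.densityProduct P ≤ (2 * K) ^ k * A.densityProduct P := by
    rw [hdens, SieveSequence.densityProduct, hP, primeFactors_primesProdBelow]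
    have hsplit : ∏ p ∈ Nat.primesBelow ⌈ζ⌉₊, (1 - gq p) =
        ∏ p ∈ (Nat.primesBelow ⌈ζ⌉₊).filter (fun p : ℕ => ¬ p ∣ q), (1 - A.density p) := by
      rw [← Finset.prod_filter_mul_prod_filter_not (Nat.primesBelow ⌈ζ⌉₊) (fun p : ℕ => ¬ p ∣ q)]
      have h2 : ∏ p ∈ (Nat.primesBelow ⌈ζ⌉₊).filter (fun p : ℕ => ¬ ¬ p ∣ q), (1 - gq p) = 1 := by
        refine Finset.prod_eq_one fun p hp => ?_
        obtain ⟨hp', hpq⟩ := Finset.mem_filter.mp hp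
        rw [not_not] at hpq
        have hpp := Nat.prime_of_mem_primesBelow hp'
        rw [hgq_apply, if_neg, sub_zero]
        exact fun hc => hpp.one_lt.ne' (Nat.Coprime.eq_one_of_dvd hc hpq)
      rw [h2, mul_one]
      refine Finset.prod_congr rfl fun p hp => ?_
      obtain ⟨hp', hpq⟩ := Finset.mem_filter.mp hp
      have hpp := Nat.prime_of_mem_primesBelow hp'
      rw [hgq_apply, if_pos ((Nat.Prime.coprime_iff_not_dvd hpp).mpr hpq)]
    rw [hsplit]
    exact prod_primesBelow_not_dvd_le hK hω hq ⌈ζ⌉₊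
  have hV0 : 0 ≤ A.densityProduct P := by
    rw [SieveSequence.densityProduct, hP, primeFactors_primesProdBelow]
    exact Finset.prod_nonneg fun p hp =>
      sub_nonneg.mpr (hK.1 p (Nat.prime_of_mem_primesBelow hp)).2.le
  have hVq0 : 0 ≤ Cq.densityProduct P := by
    rw [hdens]
    refine Finset.prod_nonneg fun p hp => sub_nonneg.mpr ?_
    rw [hgq_apply]
    split_ifs
    · exact (hK.1 p (Nat.prime_of_mem_primesBelow hp)).2.le
    · exact zero_le_one
  -- the sifted sum of `Cq`
  have hsift : Cq.sifted (x₀ / q) P = ∑ r ∈ (Ioc 0 ⌊x₀ / q⌋₊).filter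
      (fun r : ℕ => r.Coprime P ∧ r.Coprime q), A.a (q * r) := by
    show ∑ n ∈ (Ioc 0 ⌊x₀ / q⌋₊).filter (fun r : ℕ => r.Coprime P),
      (if n.Coprime q then A.a (q * n) else 0) = _
    rw [← Finset.sum_filter, Finset.filter_filter]
  -- the remainders of `Cq`
  have hrem : ∀ d ∈ P.divisors.filter (fun d : ℕ => (d : ℝ) ≤ D), |Cq.remainder d (x₀ / q)| ≤
      if d.Coprime q then ∑ e ∈ q.divisors, |(μ e : ℝ)| * |A.remainder (q * e * d) x₀| else 0 := by
    intro d _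
    rw [SieveSequence.remainder, hsize, SieveSequence.congrSum]
    show |(∑ r ∈ (Ioc 0 ⌊x₀ / q⌋₊).filter (fun r : ℕ => d ∣ r),
        (if r.Coprime q then A.a (q * r) else 0)) - gq d * (gflat * A.size x₀)| ≤ _
    rw [hgq_apply]
    by_cases hdq : d.Coprime q
    · rw [if_pos hdq, if_pos hdq]
      -- congruence sum by Möbius, and `g(d) g♭(q) = ∑_e μ(e) g(qed)`
      have hc : ∑ r ∈ (Ioc 0 ⌊x₀ / q⌋₊).filter (fun r : ℕ => d ∣ r),
          (if r.Coprime q then A.a (q * r) else 0) =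
          ∑ e ∈ q.divisors, (μ e : ℝ) * A.congrSum (q * e * d) x₀ := by
        rw [← sum_coprime_dvd_eq_sum_moebius_congrSum A hq hdq x₀]
        conv_rhs => rw [← Finset.filter_filter, Finset.sum_filter]
      have hg : A.density d * (gflat * A.size x₀) =
          ∑ e ∈ q.divisors, (μ e : ℝ) * (A.density (q * e * d) * A.size x₀) := by
        rw [hgflat, Finset.sum_mul, Finset.mul_sum]
        refine Finset.sum_congr rfl fun e he => ?_
        have heq : e ∣ q := Nat.dvd_of_mem_divisors he
        have hcop : (q * e).Coprime d :=
          Nat.Coprime.symm (Nat.Coprime.mul_right hdq (hdq.coprime_dvd_right heq))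
        rw [A.density_mult.map_mul_of_coprime hcop]
        ring
      rw [hc, hg, ← Finset.sum_sub_distrib]
      refine (Finset.abs_sum_le_sum_abs _ _).trans (Finset.sum_le_sum fun e _ => ?_)
      rw [← mul_sub, abs_mul, SieveSequence.remainder]
    · rw [if_neg hdq, if_neg hdq, zero_mul, sub_zero]
      -- no `r` with `d ∣ r` is coprime to `q`
      rw [Finset.sum_eq_zero fun r hr => ?_, abs_zero]
      obtain ⟨-, hdr⟩ := Finset.mem_filter.mp hr
      rw [if_neg]
      exact fun hrq => hdq (Nat.Coprime.coprime_dvd_left hdr hrq)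
  -- apply the fundamental lemma
  have hsz : 0 ≤ Cq.size (x₀ / q) := by rw [hsize]; exact mul_nonneg hflat hA0
  have h := hFL' Cq hKq (x₀ / q) ζ D hζ hζD hsz
  rw [← hP, hsift, hsize] at h
  have hexp : Real.exp (-(Real.log D / Real.log ζ)) ≤ 1 := by
    rw [Real.exp_le_one_iff, neg_nonpos]
    exact div_nonneg (Real.log_nonneg (by linarith)) (Real.log_nonneg (by linarith))
  have hup := (abs_sub_le_iff.mp h).1
  have hmain : gflat * A.size x₀ * Cq.densityProduct P +
      CF * (gflat * A.size x₀) * Cq.densityProduct P * Real.exp (-(Real.log D / Real.log ζ)) ≤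
      (1 + CF) * (gflat * A.size x₀) * ((2 * K) ^ k * A.densityProduct P) := by
    have hgA : 0 ≤ gflat * A.size x₀ := mul_nonneg hflat hA0
    calc gflat * A.size x₀ * Cq.densityProduct P +
          CF * (gflat * A.size x₀) * Cq.densityProduct P * Real.exp (-(Real.log D / Real.log ζ))
        ≤ gflat * A.size x₀ * Cq.densityProduct P + CF * (gflat * A.size x₀) * Cq.densityProduct P * 1 := by
          gcongr
      _ = (1 + CF) * (gflat * A.size x₀) * Cq.densityProduct P := by ring
      _ ≤ (1 + CF) * (gflat * A.size x₀) * ((2 * K) ^ k * A.densityProduct P) :=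
          mul_le_mul_of_nonneg_left hVq (mul_nonneg (by linarith) hgA)
  have hRsum : ∑ d ∈ P.divisors.filter (fun d : ℕ => (d : ℝ) ≤ D), |Cq.remainder d (x₀ / q)| ≤
      ∑ d ∈ P.divisors.filter (fun d : ℕ => (d : ℝ) ≤ D ∧ d.Coprime q),
        ∑ e ∈ q.divisors, |(μ e : ℝ)| * |A.remainder (q * e * d) x₀| := by
    refine (Finset.sum_le_sum hrem).trans (le_of_eq ?_)
    conv_rhs => rw [← Finset.filter_filter, Finset.sum_filter]
  linarith

/-- **`M(q)` is a sifted sum of `C_q`.** For `q ≠ 0` (in practice `⌈ζ⌉₊`-smooth): the `a`-mass of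
the `n ≤ x` with smooth part exactly `q` is at most
`∑_{r ≤ x/q, (r, P(ζ)) = 1, (r, q) = 1} a_{qr}` (`n ↦ n/q` is injective on this set, and `n/q` is
free of primes `< ζ` and coprime to `q`). [folklore] -/
theorem sum_smoothPart_eq_le (A : SieveSequence) {q : ℕ} (hq : q ≠ 0) (x ζ : ℝ) :
    ∑ n ∈ (Ioc 0 ⌊x⌋₊).filter (fun n : ℕ => smoothPart ⌈ζ⌉₊ n = q), A.a n ≤
      ∑ r ∈ (Ioc 0 ⌊x / q⌋₊).filter
        (fun r : ℕ => r.Coprime (primesProdBelow ζ) ∧ r.Coprime q), A.a (q * r) := by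
  have hq0 : 0 < q := Nat.pos_of_ne_zero hq
  set S := (Ioc 0 ⌊x⌋₊).filter (fun n : ℕ => smoothPart ⌈ζ⌉₊ n = q) with hS
  set T := (Ioc 0 ⌊x / q⌋₊).filter
    (fun r : ℕ => r.Coprime (primesProdBelow ζ) ∧ r.Coprime q) with hT
  have hmem : ∀ n ∈ S, n ≠ 0 ∧ q * (n / q) = n ∧ n / q ∈ T := by
    intro n hn
    obtain ⟨hn', hsm⟩ := Finset.mem_filter.mp hn
    obtain ⟨hn0, hnN⟩ := Finset.mem_Ioc.mp hn'
    have hn0' : n ≠ 0 := hn0.ne'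
    have hdvd : q ∣ n := hsm ▸ smoothPart_dvd hn0' ⌈ζ⌉₊
    have hdec : q * (n / q) = n := Nat.mul_div_cancel' hdvd
    refine ⟨hn0', hdec, Finset.mem_filter.mpr ⟨Finset.mem_Ioc.mpr ⟨?_, ?_⟩, ?_, ?_⟩⟩
    · exact Nat.div_pos (Nat.le_of_dvd hn0 hdvd) hq0
    · rw [Nat.floor_div_natCast]
      exact Nat.div_le_div_right hnN
    · rw [coprime_primesProdBelow_iff]
      intro p hp
      have hpp := Nat.prime_of_mem_primesBelow hp
      have hpB : p < ⌈ζ⌉₊ := (Nat.mem_primesBelow.mp hp).1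
      rw [← hsm]
      exact not_dvd_div_smoothPart hpp hpB hn0'
    · have := coprime_smoothPart_div (B := ⌈ζ⌉₊) hn0'
      rw [hsm] at this
      exact this.symm
  have hinj : Set.InjOn (fun n : ℕ => n / q) ↑S := by
    intro n hn n' hn' h
    obtain ⟨-, hdec, -⟩ := hmem n hn
    obtain ⟨-, hdec', -⟩ := hmem n' hn'
    rw [← hdec, ← hdec']
    exact congrArg (q * ·) h
  have himage : S.image (fun n : ℕ => n / q) ⊆ T := by
    intro r hr
    obtain ⟨n, hn, rfl⟩ := Finset.mem_image.mp hr
    exact (hmem n hn).2.2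
  calc ∑ n ∈ S, A.a n = ∑ n ∈ S, A.a (q * (n / q)) :=
        Finset.sum_congr rfl fun n hn => by rw [(hmem n hn).2.1]
    _ = ∑ r ∈ S.image (fun n : ℕ => n / q), A.a (q * r) :=
        (Finset.sum_image (g := fun n : ℕ => n / q) (f := fun r => A.a (q * r)) hinj).symm
    _ ≤ ∑ r ∈ T, A.a (q * r) :=
        Finset.sum_le_sum_of_subset_of_nonneg himage fun r _ _ => A.a_nonneg _

/-- **`g♭(q) = ∑_{e ∣ q} μ(e) g(qe) ≥ 0`** for a Bombieri sequence with `A(x₀) > 0` somewhere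
(non-degenerate case): `g♭(q) A(x)` is the `a`-mass of `{n ≤ x : q ∣ n, (n/q, q) = 1}` up to
`∑_{e ∣ q} μ(e) R(x; qe)`, which by (A₂) is `o(A(x)/1)`; a negative `g♭(q)` would force
`|g♭(q)| A(x) ≤ C A(x)/log x` for all large `x`. [folklore] -/
theorem sumMoebius_density_nonneg (A : SieveSequence) (hA : A.IsBombieriSequence)
    (hpos : ∃ x₀, 0 < A.size x₀) {q : ℕ} (hq : q ≠ 0) :
    0 ≤ ∑ e ∈ q.divisors, (μ e : ℝ) * A.density (q * e) := by
  by_contra hneg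
  rw [not_le] at hneg
  set gflat := ∑ e ∈ q.divisors, (μ e : ℝ) * A.density (q * e) with hgflat
  obtain ⟨hsize, -, h2, -⟩ := hA
  obtain ⟨x₀, hx₀⟩ := hpos
  have hsz_nonneg : ∀ x, 0 ≤ A.size x := SieveSequence.size_nonneg_of_size_eq hsize
  have hmono : ∀ x, x₀ ≤ x → A.size x₀ ≤ A.size x := by
    intro x hx
    rw [hsize, hsize, SieveSequence.congrSum, SieveSequence.congrSum]
    exact Finset.sum_le_sum_of_subset_of_nonneg
      (Finset.filter_subset_filter _ (Finset.Ioc_subset_Ioc_right (Nat.floor_le_floor hx)))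
      fun n _ _ => A.a_nonneg n
  -- the mass identity at every `x`: `0 ≤ mass = g♭ A(x) + ∑_e μ(e) R(x; qe)`
  have hmass : ∀ x : ℝ, -gflat * A.size x ≤ ∑ e ∈ q.divisors, |A.remainder (q * e) x| := by
    intro x
    have h0 : 0 ≤ ∑ r ∈ (Ioc 0 ⌊x / q⌋₊).filter (fun r : ℕ => 1 ∣ r ∧ r.Coprime q), A.a (q * r) :=
      Finset.sum_nonneg fun r _ => A.a_nonneg _
    rw [sum_coprime_dvd_eq_sum_moebius_congrSum A hq (Nat.coprime_one_left q) x] at h0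
    have hid : ∑ e ∈ q.divisors, (μ e : ℝ) * A.congrSum (q * e * 1) x =
        gflat * A.size x + ∑ e ∈ q.divisors, (μ e : ℝ) * A.remainder (q * e) x := by
      rw [hgflat, Finset.sum_mul, ← Finset.sum_add_distrib]
      refine Finset.sum_congr rfl fun e _ => ?_
      rw [SieveSequence.remainder, mul_one]
      ring
    rw [hid] at h0
    have hR : ∑ e ∈ q.divisors, (μ e : ℝ) * A.remainder (q * e) x ≤
        ∑ e ∈ q.divisors, |A.remainder (q * e) x| := by
      refine Finset.sum_le_sum fun e _ => ?_
      have hμ : |(μ e : ℝ)| ≤ 1 := by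
        rw [← Int.cast_abs]; exact_mod_cast ArithmeticFunction.abs_moebius_le_one
      calc (μ e : ℝ) * A.remainder (q * e) x ≤ |(μ e : ℝ) * A.remainder (q * e) x| := le_abs_self _
        _ = |(μ e : ℝ)| * |A.remainder (q * e) x| := abs_mul _ _
        _ ≤ 1 * |A.remainder (q * e) x| := mul_le_mul_of_nonneg_right hμ (abs_nonneg _)
        _ = |A.remainder (q * e) x| := one_mul _
    linarith
  -- (A₂) with `ε = 1/2`, `B = 1`
  obtain ⟨C, hC⟩ := h2 (1 / 2) one_half_pos 1 one_pos
  have hev : ∀ᶠ x : ℝ in atTop, -gflat * A.size x ≤ C * A.size x / Real.log x := by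
    filter_upwards [hC, eventually_gt_atTop (((q * q : ℕ) : ℝ) ^ 2), eventually_ge_atTop (1 : ℝ)]
      with x hx hxq hx1
    have hsel := hx (fun _ => x) fun _ => le_rfl
    rw [Real.rpow_one] at hsel
    refine (hmass x).trans (le_trans ?_ hsel)
    -- `e ↦ q e` injects `q.divisors` into `Ico 1 ⌈x^{1/2}⌉`
    have hinj : Set.InjOn (fun e : ℕ => q * e) ↑q.divisors := fun e _ e' _ h =>
      Nat.eq_of_mul_eq_mul_left (Nat.pos_of_ne_zero hq) h
    have himage : q.divisors.image (fun e : ℕ => q * e) ⊆ Finset.Ico 1 ⌈x ^ (1 - 1 / 2 : ℝ)⌉₊ := by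
      intro m hm
      obtain ⟨e, he, rfl⟩ := Finset.mem_image.mp hm
      have he0 := Nat.pos_of_mem_divisors he
      have heq : e ≤ q := Nat.divisor_le he
      rw [Finset.mem_Ico]
      refine ⟨Nat.one_le_iff_ne_zero.mpr (Nat.mul_ne_zero hq he0.ne'), Nat.lt_ceil.mpr ?_⟩
      rw [show (1 - 1 / 2 : ℝ) = 1 / 2 by norm_num, ← Real.sqrt_eq_rpow, Real.lt_sqrt (by positivity)]
      have h1 : ((q * e : ℕ) : ℝ) ≤ ((q * q : ℕ) : ℝ) := by exact_mod_cast Nat.mul_le_mul_left q heq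
      have h2 : (0 : ℝ) ≤ ((q * e : ℕ) : ℝ) := Nat.cast_nonneg _
      nlinarith
    calc ∑ e ∈ q.divisors, |A.remainder (q * e) x|
        = ∑ m ∈ q.divisors.image (fun e : ℕ => q * e), |A.remainder m x| :=
          (Finset.sum_image (f := fun m => |A.remainder m x|) hinj).symm
      _ ≤ ∑ d ∈ Finset.Ico 1 ⌈x ^ (1 - 1 / 2 : ℝ)⌉₊, |A.remainder d x| :=
          Finset.sum_le_sum_of_subset_of_nonneg himage fun d _ _ => abs_nonneg _
  -- choose `x` large
  have hG : 0 < -gflat := by linarith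
  obtain ⟨x, hx, hxx₀, hx1, hxlog⟩ := (hev.and ((eventually_ge_atTop x₀).and
    ((eventually_gt_atTop (1 : ℝ)).and
      (Real.tendsto_log_atTop.eventually_gt_atTop (C / (-gflat) + 1))))).exists
  have hAx : 0 < A.size x := lt_of_lt_of_le hx₀ (hmono x hxx₀)
  have hlogpos : 0 < Real.log x := Real.log_pos hx1
  have h1 : -gflat * Real.log x ≤ C := by
    have := hx
    rw [le_div_iff₀ hlogpos] at this
    nlinarith
  have h2 : C < -gflat * Real.log x := by
    have h3 : C / (-gflat) < Real.log x := by linarith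
    rwa [div_lt_iff₀ hG, mul_comm] at h3
  linarith

end BombieriSieve

end Literature.NumberTheory.Sieve
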